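import Summits.MatrixMultiplication.MatrixMultiplication.Theorems.SoloInformedSliceTransfer

/-!
# Theorem E′: the Kronecker-catalytic door for `T_cw,2` is vacuous — `z ⊠ ⟨m·3^N⟩ ⋭ z ⊠ ⟨m⟩ ⊠ T_cw,2^{⊠N}`

Solo seat `solo-MatrixMultiplication-informed` (generation 38); third of three files.  The kernel
door D11' `matrixMultiplication_of_cwTensor_two_kroneckerCatalyst` (`SoloInformedKroneckerCatalyst.lean`)
derives `ω = 2` from ONE exact catalytic degeneration

  `z ⊠ ⟨m·3^N⟩ ⊵ z ⊠ ⟨m⟩ ⊠ T_cw,2^{⊠N}`   (`z ≠ 0`, `N, m ≥ 1`).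

**Theorem E′** (`not_algDegeneratesTo_kroneckerCatalyst_cwTensor_two`, every field): no such
degeneration exists, for any non-zero catalyst `z` of any format.  Hence the door's hypothesis set
is empty (`kroneckerCatalyst_door_vacuous`): the door is sound but can never be entered, exactly
like the rank-3 door for `T_cw,2` itself (CHILV Thm. 1.1, `algBorderRank (cwTensor K 2) = 3` makes
`R = 3` impossible since `R(T_cw,2) = 4`).

Proof (slice ranks; files `SoloInformedSliceRank.lean`, `SoloInformedSliceTransfer.lean`).
1. CONCISE CORE (`exists_concise_core`): `z` is restriction-equivalent to a tensor `z'` on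
   `K^d ⊗ K^κ ⊗ K^μ`, `d = dim span{z_{a,·,·}} ≥ 1`, whose first flattening is injective; both
   sides of the degeneration may be replaced by their `z'`-versions.
2. TARGET: with `r₀ ≥ 1` the minimal rank of a non-zero slice of `z'`, every non-zero slice of
   `z' ⊠ ⟨m⟩ ⊠ T_cw,2^{⊠N}` has rank `≥ 2^N r₀` (`MinSliceRank.catalyticTarget`).
3. SOURCE: the slice of `z' ⊠ ⟨m·3^N⟩` at `γ₀ ⊗ e_{i₀}` (`γ₀` attaining `r₀`) has rank `≤ r₀`.
4. The two first index sets have the same cardinality `d·m·3^N`, so the TRANSFER LEMMA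
   (`not_algDegeneratesTo_of_minSliceRank`) gives `2^N r₀ ≤ r₀`, impossible for `N ≥ 1`.

HONEST FRAMING: this settles nothing about `ω`; it shows that the exact (`E = 0`) Kronecker-
catalytic certificate for `σ(T_cw,2) = 3` does not exist, so any proof of `R̃(T_cw,2) = 3` must use
degenerations with STRICT format excess (Fritz's resource theory: catalysts give only `≥`-rate
statements with slack).  Consistent with, and sharper than, the level-4 closure of door D11
recorded by this seat (gen 36–37, paper only).

[cite: Landsberg2017, Prop. 5.2.1.2]
[cite: BurgisserClausenShokrollahi1997, (15.19)]
[cite: Fritz2018, Thm. 1]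
[cite: ChristandlVranaZuiddam2023, §1.1]
-/

set_option linter.dupNamespace false
set_option linter.unusedSectionVars false

noncomputable section

namespace Summit.MatrixMultiplication.MatrixMultiplication.Theorems

open Literature.Computability.AlgebraicComplexity
open scoped BigOperators Polynomial Matrix

namespace SliceRank

variable {K : Type*} [Field K]

/-! ## Restrictions through the first factor; the concise core -/

section ConciseCore

variable {ι κ μ ι₂ : Type*} [Fintype ι] [Fintype κ] [Fintype μ]

/-- A tensor whose first-factor slices are combinations of those of `u` is a restriction of `u`
(matrices `(A, 1, 1)`). [cite: ChristandlVranaZuiddam2023, §1.1] -/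
theorem tensorRestrictsTo_of_first [DecidableEq κ] [DecidableEq μ] (u : ι → κ → μ → K)
    (u₂ : ι₂ → κ → μ → K) (A : ι₂ → ι → K) (h : ∀ i b c, u₂ i b c = ∑ a, A i a * u a b c) :
    TensorRestrictsTo u u₂ := by
  refine ⟨A, fun b' b => if b = b' then 1 else 0, fun c' c => if c = c' then 1 else 0,
    fun i b' c' => ?_⟩
  rw [h]
  refine Finset.sum_congr rfl fun a _ => ?_
  rw [Finset.sum_eq_single b' (fun b _ hb => by simp [hb]) (by simp),
    Finset.sum_eq_single c' (fun c _ hc => by simp [hc]) (by simp)]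
  simp

/-- **Concise core.**  Every non-zero tensor `z` is restriction-equivalent to a tensor `z'` on
`K^d ⊗ K^κ ⊗ K^μ` with `d ≥ 1` whose first flattening `γ ↦ z'(γ)` is injective (a basis of the
span of the slices `z_{a,·,·}`). [cite: Landsberg2017, §2.1 (conciseness)] -/
theorem exists_concise_core [DecidableEq κ] [DecidableEq μ] {z : ι → κ → μ → K} (hz : z ≠ 0) :
    ∃ (d : ℕ) (z' : Fin d → κ → μ → K), 0 < d ∧ (∀ γ : Fin d → K, γ ≠ 0 → slice z' γ ≠ 0) ∧
      TensorRestrictsTo z z' ∧ TensorRestrictsTo z' z := by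
  classical
  set V : Submodule K (κ → μ → K) := Submodule.span K (Set.range z) with hV
  let bV := Module.finBasis K V
  refine ⟨Module.finrank K V, fun i => (bV i : κ → μ → K), ?_, ?_, ?_, ?_⟩
  · -- `d ≥ 1`: some slice `z_a` is non-zero
    obtain ⟨a, ha⟩ : ∃ a, z a ≠ 0 := by
      by_contra h
      simp only [not_exists, not_not] at h
      exact hz (funext h)
    exact Module.finrank_pos_iff_exists_ne_zero.2
      ⟨⟨z a, Submodule.subset_span ⟨a, rfl⟩⟩, fun h0 => ha (congrArg Subtype.val h0)⟩
  · -- injectivity of the first flattening: a basis is linearly independent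
    intro γ hγ hslice
    have hsum : (∑ i, γ i • bV i : V) = 0 := by
      apply Subtype.val_injective
      funext b c
      have := congr_fun (congr_fun hslice b) c
      simpa [Submodule.coe_sum, Finset.sum_apply, Pi.smul_apply, smul_eq_mul] using this
    exact hγ (funext (Fintype.linearIndependent_iff.1 bV.linearIndependent γ hsum))
  · -- `z ≥ z'`: each basis vector is a combination of the slices of `z`
    have hmem : ∀ i, (bV i : κ → μ → K) ∈ Submodule.span K (Set.range z) := fun i => (bV i).2
    choose A hA using fun i => (Submodule.mem_span_range_iff_exists_fun K).1 (hmem i)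
    refine tensorRestrictsTo_of_first z _ A fun i b c => ?_
    have := congr_fun (congr_fun (hA i) b) c
    simp only [Finset.sum_apply, Pi.smul_apply, smul_eq_mul] at this
    exact this.symm
  · -- `z' ≥ z`: each slice of `z` is a combination of the basis
    have hmem : ∀ a, z a ∈ V := fun a => Submodule.subset_span ⟨a, rfl⟩
    refine tensorRestrictsTo_of_first _ z (fun a i => bV.repr ⟨z a, hmem a⟩ i) fun a b c => ?_
    have h2 := congrArg (fun v : V => (v : κ → μ → K) b c) (bV.sum_repr ⟨z a, hmem a⟩)
    simp only [Submodule.coe_sum, Submodule.coe_smul, Finset.sum_apply, Pi.smul_apply,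
      smul_eq_mul] at h2
    exact h2.symm

end ConciseCore

/-! ## The source: a single-block slice of `u ⊠ ⟨M⟩` -/

section Source

variable {ι κ μ : Type*} [Fintype ι] [Fintype κ] [Fintype μ]

/-- The slice of `u ⊠ ⟨M⟩` at `γ ⊗ e_{i₀}` is the slice `u(γ)` placed in the diagonal block `i₀`
(masked reindexing `D₁ · u(γ)[fst, fst] · D₂`), so its rank is at most `rank u(γ)`.
[cite: BurgisserClausenShokrollahi1997, (14.17)] -/
theorem rank_slice_kronecker_unitTensor_single_le (u : ι → κ → μ → K) (M : ℕ) (γ : ι → K)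
    (i₀ : Fin M) :
    (slice (kroneckerTensor u (unitTensor K M)) (fun p => if p.2 = i₀ then γ p.1 else 0)).rank ≤
      (slice u γ).rank := by
  classical
  obtain ⟨d₁, hd₁⟩ : ∃ d₁ : κ × Fin M → K, ∀ bj, d₁ bj = if bj.2 = i₀ then 1 else 0 :=
    ⟨_, fun _ => rfl⟩
  obtain ⟨d₂, hd₂⟩ : ∃ d₂ : μ × Fin M → K, ∀ ck, d₂ ck = if ck.2 = i₀ then 1 else 0 :=
    ⟨_, fun _ => rfl⟩
  have hinner : ∀ (a : ι) (b : κ) (j : Fin M) (c : μ) (k : Fin M),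
      ∑ i : Fin M, (if i = i₀ then γ a else 0) * kroneckerTensor u (unitTensor K M) (a, i) (b, j) (c, k) =
        d₁ (b, j) * (γ a * u a b c) * d₂ (c, k) := by
    intro a b j c k
    rw [Finset.sum_eq_single i₀ (fun i _ hi => by simp [hi]) (by simp), hd₁, hd₂]
    by_cases hj : j = i₀
    · by_cases hk : k = i₀
      · subst hj; subst hk; simp
      · subst hj; simp [hk, Ne.symm hk]
    · by_cases hk : k = i₀
      · subst hk; simp [hj, Ne.symm hj]
      · simp [hj, hk, Ne.symm hj]
  set S : Matrix (κ × Fin M) (μ × Fin M) K :=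
    (slice u γ).submatrix (Prod.fst : κ × Fin M → κ) (Prod.fst : μ × Fin M → μ) with hS
  have hT : slice (kroneckerTensor u (unitTensor K M)) (fun p => if p.2 = i₀ then γ p.1 else 0) =
      Matrix.diagonal d₁ * S * Matrix.diagonal d₂ := by
    ext ⟨b, j⟩ ⟨c, k⟩
    simp only [hS, Matrix.mul_diagonal, Matrix.diagonal_mul, Matrix.submatrix_apply, slice_apply,
      Fintype.sum_prod_type, Finset.mul_sum, Finset.sum_mul]
    exact Finset.sum_congr rfl fun a _ => hinner a b j c k
  rw [hT]
  calc (Matrix.diagonal d₁ * S * Matrix.diagonal d₂).rank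
      ≤ (Matrix.diagonal d₁ * S).rank := Matrix.rank_mul_le_left _ _
    _ ≤ S.rank := Matrix.rank_mul_le_right _ _
    _ ≤ (slice u γ).rank := Matrix.rank_submatrix_le _ _ _

end Source

end SliceRank

/-! ## Theorem E′ -/

section TheoremE

open SliceRank

variable {K : Type*} [Field K] {ι' κ' μ' : Type*} [Fintype ι'] [Fintype κ'] [Fintype μ']

/-- **Theorem E′ (every field).**  For a non-zero tensor `z` of any format and `N, m ≥ 1` there is
NO degeneration `z ⊠ ⟨m·3^N⟩ ⊵ z ⊠ ⟨m⟩ ⊠ T_cw,2^{⊠N}`: the exact Kronecker-catalytic certificate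
for `σ(T_cw,2) = 3` does not exist.  (Slice ranks: the target's non-zero slices have rank
`≥ 2^N r₀`, the source has a non-zero slice of rank `r₀`, and at equal first format a degeneration
cannot raise the minimal slice rank.) [cite: Landsberg2017, Prop. 5.2.1.2]
[cite: BurgisserClausenShokrollahi1997, (15.19)] -/
theorem not_algDegeneratesTo_kroneckerCatalyst_cwTensor_two {z : ι' → κ' → μ' → K} (hz : z ≠ 0)
    {N m : ℕ} (hN : N ≠ 0) (hm : m ≠ 0) :
    ¬ AlgDegeneratesTo (kroneckerTensor z (unitTensor K (m * 3 ^ N)))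
        (kroneckerTensor z (kroneckerTensor (unitTensor K m) (kroneckerPow (cwTensor K 2) N))) := by
  classical
  intro hdeg
  -- (1) concise core
  obtain ⟨d, z', hd, hconc, h1, h2⟩ := exists_concise_core hz
  have hdeg' : AlgDegeneratesTo (kroneckerTensor z' (unitTensor K (m * 3 ^ N)))
      (kroneckerTensor z' (kroneckerTensor (unitTensor K m) (kroneckerPow (cwTensor K 2) N))) :=
    ((h2.kronecker (TensorRestrictsTo.refl _)).algDegeneratesTo_trans hdeg).trans_restrictsTo
      (h1.kronecker (TensorRestrictsTo.refl _))
  -- (2) the minimal slice rank `r₀ ≥ 1` of `z'`, attained at `γ₀`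
  have h1ne : (fun _ : Fin d => (1 : K)) ≠ 0 := fun h0 =>
    (one_ne_zero : (1 : K) ≠ 0) (by simpa using congr_fun h0 ⟨0, hd⟩)
  have hex : ∃ n, ∃ γ : Fin d → K, γ ≠ 0 ∧ (slice z' γ).rank = n := ⟨_, _, h1ne, rfl⟩
  obtain ⟨γ₀, hγ₀, hr₀⟩ := Nat.find_spec hex
  have hmin : MinSliceRank z' (Nat.find hex) := fun γ hγ => Nat.find_min' hex ⟨γ, hγ, rfl⟩
  have hr₀pos : 1 ≤ Nat.find hex := by
    rw [← hr₀]
    exact one_le_rank_of_ne_zero (hconc γ₀ hγ₀)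
  -- (3) target: every non-zero slice has rank `≥ 2^N r₀`
  have ht := hmin.catalyticTarget m N
  -- (4) source: the slice at `γ₀ ⊗ e_{i₀}` has rank `≤ r₀ < 2^N r₀`
  have hMpos : 0 < m * 3 ^ N := Nat.mul_pos (Nat.pos_of_ne_zero hm) (pow_pos (by norm_num) N)
  obtain ⟨a₀, ha₀⟩ : ∃ a, γ₀ a ≠ 0 := by
    by_contra h
    simp only [not_exists, not_not] at h
    exact hγ₀ (funext h)
  have hα₀ : (fun p : Fin d × Fin (m * 3 ^ N) => if p.2 = (⟨0, hMpos⟩ : Fin (m * 3 ^ N))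
      then γ₀ p.1 else 0) ≠ 0 := by
    intro h0
    exact ha₀ (by simpa using congr_fun h0 (a₀, ⟨0, hMpos⟩))
  have hsrc : (slice (kroneckerTensor z' (unitTensor K (m * 3 ^ N)))
      (fun p : Fin d × Fin (m * 3 ^ N) => if p.2 = (⟨0, hMpos⟩ : Fin (m * 3 ^ N))
        then γ₀ p.1 else 0)).rank < 2 ^ N * Nat.find hex := by
    have h2 : 2 ≤ 2 ^ N :=
      calc (2 : ℕ) = 2 ^ 1 := by norm_num
        _ ≤ 2 ^ N := Nat.pow_le_pow_right (by norm_num) (Nat.one_le_iff_ne_zero.2 hN)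
    calc _ ≤ (slice z' γ₀).rank := rank_slice_kronecker_unitTensor_single_le z' _ γ₀ _
      _ = Nat.find hex := hr₀
      _ < 2 * Nat.find hex := by omega
      _ ≤ 2 ^ N * Nat.find hex := Nat.mul_le_mul_right _ h2
  -- (5) equal first formats: transfer
  have hcard : Fintype.card (Fin d × (Fin m × (Fin N → Fin 3))) =
      Fintype.card (Fin d × Fin (m * 3 ^ N)) := by
    simp [Fintype.card_prod, Fintype.card_fin]
  exact not_algDegeneratesTo_of_minSliceRank ht (Fintype.equivOfCardEq hcard) hα₀ hsrc hdeg'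

/-- Theorem E′ with the factors `N = 0` or `m = 0` or `z = 0` put back: the degeneration exists
ONLY in the degenerate cases (for `N = 0` both sides are `z ⊠ ⟨m⟩` up to relabelling; for
`m = 0` or `z = 0` both sides vanish). Stated as the contrapositive actually used by the door.
[cite: Landsberg2017, Prop. 5.2.1.2] -/
theorem eq_zero_or_of_algDegeneratesTo_kroneckerCatalyst {z : ι' → κ' → μ' → K} {N m : ℕ}
    (h : AlgDegeneratesTo (kroneckerTensor z (unitTensor K (m * 3 ^ N)))
      (kroneckerTensor z (kroneckerTensor (unitTensor K m) (kroneckerPow (cwTensor K 2) N)))) :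
    z = 0 ∨ N = 0 ∨ m = 0 := by
  by_contra hne
  simp only [not_or] at hne
  exact not_algDegeneratesTo_kroneckerCatalyst_cwTensor_two hne.1 hne.2.1 hne.2.2 h

/-- **The Kronecker-catalytic door D11' is vacuous**: the hypothesis set of
`matrixMultiplication_of_cwTensor_two_kroneckerCatalyst` — a non-zero complex catalyst `z`,
`N, m ≥ 1` and a degeneration `z ⊠ ⟨m·3^N⟩ ⊵ z ⊠ ⟨m⟩ ⊠ T_cw,2^{⊠N}` — is EMPTY.  The door is a
correct implication that can never be applied. [cite: Fritz2018, Thm. 1] -/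
theorem kroneckerCatalyst_door_vacuous :
    ¬ ∃ (ι' κ' μ' : Type) (_ : Fintype ι') (_ : Fintype κ') (_ : Fintype μ')
        (z : ι' → κ' → μ' → ℂ) (N m : ℕ), z ≠ 0 ∧ N ≠ 0 ∧ m ≠ 0 ∧
        AlgDegeneratesTo (kroneckerTensor z (unitTensor ℂ (m * 3 ^ N)))
          (kroneckerTensor z (kroneckerTensor (unitTensor ℂ m) (kroneckerPow (cwTensor ℂ 2) N))) := by
  rintro ⟨ι', κ', μ', _, _, _, z, N, m, hz, hN, hm, h⟩
  exact not_algDegeneratesTo_kroneckerCatalyst_cwTensor_two hz hN hm h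

/-- The special case `m = 1`, i.e. the plain catalytic form `z ⊠ ⟨3^N⟩ ⊵ z ⊠ ⟨1⟩ ⊠ T_cw,2^{⊠N}`
(equivalently `z ⊠ ⟨3^N⟩ ⊵ z ⊠ T_cw,2^{⊠N}` up to the trivial factor), is likewise impossible for
every non-zero `z` and `N ≥ 1`. [cite: Landsberg2017, Prop. 5.2.1.2] -/
theorem not_algDegeneratesTo_catalyst_cwTensor_two_pow {z : ι' → κ' → μ' → K} (hz : z ≠ 0)
    {N : ℕ} (hN : N ≠ 0) :
    ¬ AlgDegeneratesTo (kroneckerTensor z (unitTensor K (1 * 3 ^ N)))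
        (kroneckerTensor z (kroneckerTensor (unitTensor K 1) (kroneckerPow (cwTensor K 2) N))) :=
  not_algDegeneratesTo_kroneckerCatalyst_cwTensor_two hz hN one_ne_zero

end TheoremE

end Summit.MatrixMultiplication.MatrixMultiplication.Theorems

end
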